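import Mathlib
import Literature.Combinatorics.Enumerative.EntropyBregmanChainRule

/-!
# Stub `stub_chainTelescope` (crux stmt-MatrixMultiplication-8303, line bregman-entropy-window)

Crux `Summit.MatrixMultiplication.MatrixMultiplication.Theses.SnSubsetDichotomy.GlobalBranch`, line
`bregman-entropy-window` (lead's skeleton `Cruxes/GlobalBranch/Lines/bregman_entropy_window.lean`),
registered stub `stub_chainTelescope`: the **chain rule summed over all orders**, the purely
combinatorial half of Radhakrishnan's random-order entropy proof of Brégman's theorem (and of the
Cuckler–Kahn "−1 nat per vertex" bound for the uniform measure on `X ⊆ S_n`).  For a finite set `X`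
of permutations of `Fin n`, a set of rows `B` and `σ ∈ X` write `F_B(σ) = {σ' ∈ X : σ' = σ on B}`, and
for an order `τ ∈ S_n` of the rows ("row `τ k` is revealed at step `k`") let
`B(τ,i) = {i' : τ⁻¹ i' < τ⁻¹ i}` be the rows revealed before row `i`.  Then

  `n ! · #X · log #X = ∑_i ∑_τ ∑_{σ ∈ X} (log #F_{B(τ,i)}(σ) - log #F_{B(τ,i) ∪ {i}}(σ))`

(the fibre over `B(τ,i) ∪ {i}` is written with the extra conjunct `σ' i = σ i`): for fixed `τ` and
`σ` the inner summands telescope from `log #X` to `log #{σ} = 0` along the order `τ`.  In the line the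
lead combines it with the Gibbs step `stub_gibbsStep` into `stub_chainGibbs`.

The proof is the general theorem
`Literature.Combinatorics.Enumerative.factorial_mul_card_mul_log_card_eq_sum_chain` (which needs no
nonemptiness: for `X = ∅` both sides vanish).
-/

set_option linter.dupNamespace false

namespace Summit.MatrixMultiplication.MatrixMultiplication.Theorems.GlobalBranch

open scoped BigOperators Classical

/-- **Stub `stub_chainTelescope` — the chain rule summed over all orders.**  For every `n` and every
nonempty finite set `X` of permutations of `Fin n`, with `F_B(σ) = {σ' ∈ X : σ' = σ on B}` and
`B(τ,i) = {i' : τ⁻¹ i' < τ⁻¹ i}` (rows revealed before `i` in the order `τ`):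
`n ! · #X · log #X = ∑_i ∑_τ ∑_{σ ∈ X} (log #F_{B(τ,i)}(σ) - log #F_{B(τ,i) ∪ {i}}(σ))` — revealing
the rows of `σ` in the order `τ`, `log #X` telescopes through the fibres
(`Literature.Combinatorics.Enumerative.factorial_mul_card_mul_log_card_eq_sum_chain`).
[cite: Radhakrishnan1997, proof of Thm 1] -/
theorem stub_chainTelescope : ∀ (n : ℕ) (X : Finset (Equiv.Perm (Fin n))), X.Nonempty →
    ((n.factorial : ℝ) * (X.card : ℝ)) * Real.log (X.card : ℝ) =
      ∑ i : Fin n, ∑ τ : Equiv.Perm (Fin n), ∑ σ ∈ X,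
        (Real.log ((X.filter (fun σ' => ∀ i' ∈ Finset.univ.filter (fun i' => τ.symm i' < τ.symm i),
            σ' i' = σ i')).card : ℝ) -
          Real.log ((X.filter (fun σ' => (∀ i' ∈ Finset.univ.filter (fun i' => τ.symm i' < τ.symm i),
            σ' i' = σ i') ∧ σ' i = σ i)).card : ℝ)) :=
  fun _ X _ => Literature.Combinatorics.Enumerative.factorial_mul_card_mul_log_card_eq_sum_chain X

end Summit.MatrixMultiplication.MatrixMultiplication.Theorems.GlobalBranch
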